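import Mathlib
import HarnessLib
import Summits.CriticalPhenomena.PercolationContinuityZ3.Theses.PercLowPointHalfSpace
import Summits.CriticalPhenomena.PercolationContinuityZ3.Theorems.PercLowPointHalfSpaceLowPointBookkeepingSharpReduce
import Literature.Probability.LatticeModels.ProdBernoulliCoupling
import Literature.Probability.LatticeModels.IsoradialPercolationProofs

/-!
# B♯ follows from its BULK form (line SketchIdeator1, crux `LowPointBookkeeping`)

Helper file of line SketchIdeator1 (skeleton floor-russo) for the crux `LowPointBookkeeping`
(stmt-CriticalPhenomena-14713, route PercLowPointHalfSpace).  The canonical hypothesis-stub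
`stub_noFatHalfBoxOrigin` (B♯) is a statement about half-space clusters under the induced half-space
measure `P^{ℍ}_{p_c,1}`.  It follows from the purely BULK statement

  `BulkNoFat`: `P_{p_c}(|K_max(B_n)| ≥ C n^{11/4}) ≤ e^{-1}` for all `n ≥ 1`

("the largest critical cluster trace in the box `B_n` of `ℤ³` has typically at most `C n^{11/4}`
sites"; real world `|K_max(B_n)| ≈ n^{d_f}`, `d_f = 2.523`), with the same constant:
`P^{ℍ}_{p_c,1} ≤ P_{p_c}` on increasing events (the half-space weights are dominated by the bulk
weights, `prodBernoulli_mono_of_isUpperSet`), `{|K_max(Λ)| ≥ k}` is increasing, and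
`|K_max(B_n ∩ ℍ)| ≤ |K_max(B_n)|` (`Reduce.clusterMaxIn_mono_set`).

* `floorDiluted_le_bond_of_isUpperSet` — `P^{ℍ}_{p_c,s}(A) ≤ P_{p_c}(A)` for increasing measurable `A`;
* `noFatHalfBoxOrigin_of_bulk` — BulkNoFat ⇒ B♯ (registered wrapper `stub_noFatOfBulk`).

CAVEAT (status of BulkNoFat).  `clusterMaxIn (box 3 n)` counts traces of FULL-SPACE clusters
(`(openGraph ω).Reachable`, paths may leave the box), so under `P_{p_c}` with `θ(p_c) > 0` the unique
infinite cluster alone would give `|K_max(B_n)| ≥ |C_∞ ∩ B_n| ≈ θ |B_n|` with probability `→ 1`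
(uniqueness + spatial ergodicity): BulkNoFat implies `θ(p_c) = 0` by a soft argument that bypasses
the line, i.e. it is a rate-form costume of the conjunct and is recorded here only as the trivial
upper envelope of B♯.  The informative hypothesis remains B♯ itself: under `P^{ℍ}_{p_c,1}` the
configuration lives on half-space edges, every cluster is an `ℍ`-cluster and a.s. FINITE
(Barsky–Grimmett–Newman), and no such soft argument applies.
-/

noncomputable section

open MeasureTheory Filter Topology
open Literature.Probability.Percolation Literature.Probability.LatticeModels
open scoped ENNReal Classical

namespace Summit.CriticalPhenomena.PercolationContinuityZ3.Theorems.FloorRusso.NoFatBulk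

/-- The critical bond percolation measure on `ℤ³` (local notation). -/
local notation3 (prettyPrint := false) "μc" =>
  (bondPercolation (zdGraph 3) (criticalProbI 3) : Measure (BondConfig (Site 3)))

/-- The floor-diluted critical half-space measure at floor density `s` (local notation). -/
local notation3 (prettyPrint := false) "μH" =>
  (fun s : unitInterval => (floorDilutedPercolation 3 (criticalProbI 3) s : Measure (BondConfig (Site 3))))

/-- The half-box `Λ_n = B_n ∩ ℍ` (local notation). -/
local notation3 (prettyPrint := false) "Λ⟦" n "⟧" => ((box 3 n).filter fun z : Site 3 => 0 ≤ z 0)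

/-- The floor-diluted weights are dominated by the bulk weights `p · 𝟙[lattice edge]`. -/
theorem floorDilutedParam_le_indicator (p s : unitInterval) (e : Sym2 (Site 3)) :
    floorDilutedParam 3 p s e ≤ (if e ∈ (zdGraph 3).edgeSet then p else 0) := by
  by_cases he : e ∈ (zdGraph 3).edgeSet
  · rw [if_pos he]
    exact floorDilutedParam_le _ _ _
  · rw [if_neg he, floorDilutedParam_of_not_mem_halfSpaceEdgeSet _ _ fun h => he h.1]

/-- **`P^{ℍ}_{p_c,s} ≤ P_{p_c}` on increasing measurable events** (monotone coupling of product
Bernoulli measures with ordered weights). -/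
theorem floorDiluted_le_bond_of_isUpperSet (s : unitInterval) {A : Set (BondConfig (Site 3))}
    (hA : IsUpperSet A) (hAm : MeasurableSet A) : (μH s) A ≤ (μc) A := by
  have hq : prodBernoulli (fun e : Sym2 (Site 3) => if e ∈ (zdGraph 3).edgeSet then criticalProbI 3 else 0) =
      (μc) := prodBernoulli_indicator_holds _ _
  rw [← hq]
  exact prodBernoulli_mono_of_isUpperSet (fun e => floorDilutedParam_le_indicator _ s e) hA hAm

/-- **B♯ from its bulk form.**  If the largest cluster trace in the full box `B_n` of `ℤ³` is typically
at most `C n^{11/4}` under `P_{p_c}`, then the canonical stub `stub_noFatHalfBoxOrigin` holds with the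
same constant. -/
theorem noFatHalfBoxOrigin_of_bulk
    (h : ∃ C : ℝ, 0 < C ∧ ∀ n : ℕ, 1 ≤ n →
      (μc).real {ω | C * (n : ℝ) ^ ((11 : ℝ) / 4) ≤ (clusterMaxIn (box 3 n) ω : ℝ)} ≤ Real.exp (-1)) :
    ∃ C : ℝ, 0 < C ∧ ∀ n : ℕ, 1 ≤ n →
      (μH 1).real {ω | C * (n : ℝ) ^ ((11 : ℝ) / 4) ≤ (clusterMaxIn Λ⟦n⟧ ω : ℝ)} ≤ Real.exp (-1) := by
  obtain ⟨C, hC, h⟩ := h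
  refine ⟨C, hC, fun n hn => ?_⟩
  obtain ⟨k, hk⟩ : ∃ k : ℕ, k = ⌈C * (n : ℝ) ^ ((11 : ℝ) / 4)⌉₊ := ⟨_, rfl⟩
  have hset : ∀ Λ : Finset (Site 3),
      ({ω : BondConfig (Site 3) | C * (n : ℝ) ^ ((11 : ℝ) / 4) ≤ (clusterMaxIn Λ ω : ℝ)}) =
        {ω | k ≤ clusterMaxIn Λ ω} := by
    intro Λ
    ext ω
    simp only [Set.mem_setOf_eq, hk, Nat.ceil_le]
  have h2 : (μH 1) {ω | k ≤ clusterMaxIn Λ⟦n⟧ ω} ≤ (μc) {ω | k ≤ clusterMaxIn Λ⟦n⟧ ω} :=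
    floorDiluted_le_bond_of_isUpperSet 1 (isUpperSet_clusterMaxIn_ge _ _)
      (measurableSet_clusterMaxIn_ge _ _)
  have h3 : ({ω : BondConfig (Site 3) | k ≤ clusterMaxIn Λ⟦n⟧ ω}) ⊆ {ω | k ≤ clusterMaxIn (box 3 n) ω} :=
    fun ω hω => le_trans hω (Reduce.clusterMaxIn_mono_set (Finset.filter_subset _ _) ω)
  calc (μH 1).real {ω | C * (n : ℝ) ^ ((11 : ℝ) / 4) ≤ (clusterMaxIn Λ⟦n⟧ ω : ℝ)}
      = (μH 1).real {ω | k ≤ clusterMaxIn Λ⟦n⟧ ω} := by rw [hset]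
    _ ≤ (μc).real {ω | k ≤ clusterMaxIn Λ⟦n⟧ ω} := by
        simp only [measureReal_def]
        exact ENNReal.toReal_mono (measure_ne_top _ _) h2
    _ ≤ (μc).real {ω | k ≤ clusterMaxIn (box 3 n) ω} := measureReal_mono h3 (measure_ne_top _ _)
    _ = (μc).real {ω | C * (n : ℝ) ^ ((11 : ℝ) / 4) ≤ (clusterMaxIn (box 3 n) ω : ℝ)} := by rw [hset]
    _ ≤ Real.exp (-1) := h n hn

/-! ### Registered wrapper -/

/-- **Registered wrapper `stub_noFatOfBulk`**: the bulk no-fat-box statement under `P_{p_c}` implies the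
canonical `stub_noFatHalfBoxOrigin`; verbatim `noFatHalfBoxOrigin_of_bulk`. -/
theorem stub_noFatOfBulk : (∃ C : ℝ, 0 < C ∧ ∀ n : ℕ, 1 ≤ n → (bondPercolation (zdGraph 3) (criticalProbI 3)).real {ω | C * (n : ℝ) ^ ((11 : ℝ) / 4) ≤ (clusterMaxIn (box 3 n) ω : ℝ)} ≤ Real.exp (-1)) → (∃ C : ℝ, 0 < C ∧ ∀ n : ℕ, 1 ≤ n → (floorDilutedPercolation 3 (criticalProbI 3) 1).real {ω | C * (n : ℝ) ^ ((11 : ℝ) / 4) ≤ (clusterMaxIn ((box 3 n).filter fun z : Site 3 => 0 ≤ z 0) ω : ℝ)} ≤ Real.exp (-1)) :=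
  noFatHalfBoxOrigin_of_bulk

end Summit.CriticalPhenomena.PercolationContinuityZ3.Theorems.FloorRusso.NoFatBulk

end
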